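import Summits.AtomisticToContinuum.FouriersLaw.Theorems.HiddenChargeMazurOddChargeAlgebraPeelingLemmas
import Summits.AtomisticToContinuum.FouriersLaw.Theorems.HiddenChargeMazurOddChargeAlgebraCplus

/-!
# Odd conservation laws of the pinned anharmonic chain — weight peeling (THEOREM R)

The reduction of the classification of the momentum-odd polynomial local conservation laws of
`pinnedChain ω₂ lam β γ` (`lam ≠ 0`, `β ≠ 0`) to the homogeneous quartic chain.  Using the grading
lemmas of file `…PeelingLemmas` (`L₊ = lplus` raises the weight `wt` (`q ↦ 1`, `p ↦ 2`) by
exactly one, `L₋ = lminus` lowers it by one, momentum reversal commutes with the weight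
components):

* WEIGHT PEELING (`eq_zero_of_nf_liouville_eq_zero`): a left-aligned (`N g = g`) odd `g` with
  `N (L g) = 0` vanishes — its top weight component `f` is left-aligned, odd, `wt`-homogeneous
  with `N (L₊ f) = 0`, so `f = 0` by THEOREM C₊ (`cplus`);
* THEOREM R (`odd_law_coboundary`): an odd polynomial density `g` on the sites `[0, M]` with
  `L g ∈ (1 - S)𝓡` is a shift-coboundary `g = S χ - χ` with `χ` on the sites `[0, M - 1]`
  (normal form `N g`, `g - N g ∈ (1 - S)𝓡`, translation covariance of `L`, weight peeling).
[folklore]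
-/

noncomputable section

open MvPolynomial Finsupp
open scoped BigOperators

namespace Summit.AtomisticToContinuum.FouriersLaw.Theorems.OddChargeAlgebra

/-! ## Weight peeling and THEOREM R -/

/-- WEIGHT PEELING.  A left-aligned (`N g = g`), momentum-odd polynomial `g` with `N (L g) = 0`
vanishes (`lam ≠ 0`, `β ≠ 0`): otherwise its top weight component `f` (weight `W`) is nonzero,
left-aligned, odd and `wt`-homogeneous, and `N (L₊ f) = N (component_{W+1} (L g)) =
component_{W+1} (N (L g)) = 0` because `L = L₊ + L₋` with `L₊` raising and `L₋` lowering the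
weight by one — contradicting THEOREM C₊. [folklore] -/
theorem eq_zero_of_nf_liouville_eq_zero (ω₂ lam β : ℝ) (hl : lam ≠ 0) (hb : β ≠ 0) {g : R}
    (hal : nf g = g) (hodd : rev g = -g) (hNL : nf (liouville ω₂ lam β g) = 0) : g = 0 := by
  by_contra hne
  obtain ⟨d₀, hd₀⟩ := MvPolynomial.ne_zero_iff.mp hne
  obtain ⟨m₀, hm₀, hmax⟩ := Finset.exists_max_image g.support (fun m => weight wt m)
    ⟨d₀, MvPolynomial.mem_support_iff.mpr hd₀⟩
  refine weightedHomogeneousComponent_ne_zero_of_mem_support hm₀ (cplus lam β _ (weight wt m₀) hl hb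
    ?_ ?_ (weightedHomogeneousComponent_isWeightedHomogeneous _ g) ?_)
  · rw [nf_weightedHomogeneousComponent_wt, hal]
  · rw [rev_weightedHomogeneousComponent, hodd, map_neg]
  · rw [← weightedHomogeneousComponent_liouville_top ω₂ lam β hmax, nf_weightedHomogeneousComponent_wt,
      hNL, map_zero]

/-- THEOREM R (reduction to the quartic chain).  Every momentum-odd polynomial density `g` on the
sites `[0, M]` whose Liouville derivative is a shift-coboundary, `L g = ψ - S ψ`, is itself a
shift-coboundary `g = S χ - χ` with `χ` on the sites `[0, M-1]` (`lam ≠ 0`, `β ≠ 0`, `ω₂`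
arbitrary).  Proof: `g - N g = χ₀ - S χ₀`; by translation covariance `L (N g) =
(ψ - L χ₀) - S (ψ - L χ₀)`, so `N (L (N g)) = 0`; `N g` is left-aligned and odd, hence `N g = 0`
by weight peeling, and `g = χ₀ - S χ₀ = S (-χ₀) - (-χ₀)`. [folklore] -/
theorem odd_law_coboundary : ∀ (ω₂ lam β : ℝ) (M : ℕ) (g ψ : R), lam ≠ 0 → β ≠ 0 →
    g ∈ supported ℝ (Var.site ⁻¹' Set.Icc (0 : ℤ) M) → rev g = -g →
    liouville ω₂ lam β g = ψ - shift ψ →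
    ∃ χ : R, χ ∈ supported ℝ (Var.site ⁻¹' Set.Icc (0 : ℤ) ((M : ℤ) - 1)) ∧ g = shift χ - χ := by
  intro ω₂ lam β M g ψ hl hb hg hodd hlaw
  obtain ⟨χ₀, hχ₀, hχ⟩ := exists_sub_nf M g hg
  have hg' : nf g = g - (χ₀ - shift χ₀) := by rw [← hχ]; abel
  have hNL : nf (liouville ω₂ lam β (nf g)) = 0 := by
    have h1 : liouville ω₂ lam β (nf g) =
        (ψ - liouville ω₂ lam β χ₀) - shift (ψ - liouville ω₂ lam β χ₀) := by
      rw [hg', map_sub, map_sub, hlaw, ← shift_liouville, map_sub]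
      abel
    rw [h1]
    exact nf_sub_shift _
  have hodd' : rev (nf g) = -nf g := by rw [rev_nf, hodd, map_neg]
  have hzero : nf g = 0 := eq_zero_of_nf_liouville_eq_zero ω₂ lam β hl hb (nf_nf g) hodd' hNL
  refine ⟨-χ₀, neg_mem hχ₀, ?_⟩
  rw [hzero, sub_zero] at hχ
  rw [map_neg, hχ]
  abel

end Summit.AtomisticToContinuum.FouriersLaw.Theorems.OddChargeAlgebra

end
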